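import Mathlib
import Summits.QuantumFields.QCD.Theses.PauliWegnerSea

/-!
Sketch for crux-ideate stmt-QuantumFields-11512 (FMClosureUnquenched), ideator 2.
First lemmas of the idea cards; they need not be proved here, only elaborate.
-/

namespace Summit.QuantumFields.QCD.Cruxes.FMClosureUnquenched.Sketch

open scoped BigOperators Matrix ComplexConjugate
open MeasureTheory Filter

/-- Card `sea-factorises-across-collars`, first lemma (the lever's formula, pure matrix calculus):
the mixed second variation of `log |det|` along two perturbations is minus the real part of the
trace of the product of the two "cross propagators":
`∂ₛ∂ₜ log‖det(A + sB + tC)‖ |₀ = -Re tr(A⁻¹ B A⁻¹ C)` (Jacobi's formula twice).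
With `A = D_W(U)`, `B` supported on the links of a set `X`, `C` on the links of a far set `Y`,
the right-hand side only involves the blocks `G(X→Y)`, `G(Y→X)` of `G = A⁻¹`. -/
def JacobiCross : Prop :=
  ∀ (n : ℕ) (A B C : Matrix (Fin n) (Fin n) ℂ), A.det ≠ 0 →
    deriv (fun s : ℝ => deriv (fun t : ℝ =>
        Real.log ‖(A + (s : ℂ) • B + (t : ℂ) • C).det‖) 0) 0
      = -((A⁻¹ * B * A⁻¹ * C).trace).re

/-- Card `sea-factorises-across-collars`, support: three-region Schur identity behind the
Cè–Giusti–Schaefer factorisation.  If region `0` and region `2` do not hop to each other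
directly (the middle region is a collar), then
`det M = det A · det K · det(D - C A⁻¹ B - E K⁻¹ F)`,
so `det M / (det M₀₁ · det M₁₂ / det D)`-type remainders are `det(1 - w)` with `w` built from
the two one-sided Schur corrections (here stated in the raw block form). -/
def ThreeRegionSchur : Prop :=
  ∀ (n₀ n₁ n₂ : ℕ) (A : Matrix (Fin n₀) (Fin n₀) ℂ) (B : Matrix (Fin n₀) (Fin n₁) ℂ)
    (C : Matrix (Fin n₁) (Fin n₀) ℂ) (D : Matrix (Fin n₁) (Fin n₁) ℂ)
    (E : Matrix (Fin n₁) (Fin n₂) ℂ) (F : Matrix (Fin n₂) (Fin n₁) ℂ)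
    (K : Matrix (Fin n₂) (Fin n₂) ℂ), IsUnit A.det → IsUnit K.det →
    (Matrix.fromBlocks A (Matrix.of fun i j => Sum.elim (fun j₁ => B i j₁) (fun _ => 0) j)
        (Matrix.of fun i j => Sum.elim (fun i₁ => C i₁ j) (fun _ => 0) i)
        (Matrix.fromBlocks D E F K)).det
      = A.det * K.det * (D - C * A⁻¹ * B - E * K⁻¹ * F).det


/-- Card `von-mises-circles`, first lemma (provable now): along the U(1) coset
`θ ↦ U_e · diag(e^{iθ}, e^{-iθ}, 1)` of ONE link the Wilson action is a pure first harmonic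
`a cos θ + b sin θ + c` (plaquettes are linear in `U_e`; `Re tr(M·T(θ)) = Re(M₁₁e^{iθ} + M₂₂e^{-iθ} + M₃₃)`),
so the conditional law of `θ` under `exp(-β·wilsonAction)·Haar` given the coset is von Mises:
`∝ exp(κ cos(θ - θ*)) dθ`, unimodal for EVERY `κ = β·|(a,b)| ≥ 0`. Typed exactly like the route's
`PauliBandLimit` (the one-parameter family is quantified with its diagonal form). -/
def CircleFirstHarmonic : Prop :=
  ∀ (L : ℕ) [NeZero L]
    (U : Literature.MathematicalPhysics.QuantumFieldTheory.GaugeConfig 4 L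
      (Matrix.specialUnitaryGroup (Fin 3) ℂ))
    (e : Literature.MathematicalPhysics.QuantumFieldTheory.Edge 4 L)
    (T : ℝ → Matrix.specialUnitaryGroup (Fin 3) ℂ),
    (∀ θ : ℝ, ((T θ : Matrix.specialUnitaryGroup (Fin 3) ℂ) : Matrix (Fin 3) (Fin 3) ℂ) =
      Matrix.diagonal ![Complex.exp (θ * Complex.I), Complex.exp (-(θ * Complex.I)), 1]) →
    ∃ a b c : ℝ, ∀ θ : ℝ,
      Literature.MathematicalPhysics.QuantumFieldTheory.wilsonAction
          (Literature.MathematicalPhysics.QuantumLattice.fundamentalRep (Fin 3))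
          (Function.update U e (U e * T θ))
        = a * Real.cos θ + b * Real.sin θ + c

/-- Card `von-mises-circles`, the determinant side along the same circle (numerically certified by the
route's kit j002689 and the refuters; provable now): `θ ↦ det D_W(U[e ↦ U_e T(θ)])` has Fourier support
in `[-4, 4]` — restated from the route's `PauliBandLimit` for the reader; the card's 1-D small-ball lemma
is about ratios `|Q(θ)|^{-s}` of such trigonometric polynomials under the von Mises × `|P|` law. -/
def CircleBandLimit : Prop :=
  Summit.QuantumFields.QCD.Theses.PauliWegnerSea.PauliBandLimit

end Summit.QuantumFields.QCD.Cruxes.FMClosureUnquenched.Sketch
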